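import Summits.QuantumFields.BalabanUV.T4Continuum.Support.NE7MeanZeroGaugeSliceW
import Summits.QuantumFields.BalabanUV.T4Continuum.Support.NE3FrameFreeDecompositionW
import Summits.QuantumFields.BalabanUV.T4Continuum.Support.NE3CornerGaugePoincare
import Summits.QuantumFields.BalabanUV.T4Continuum.Support.NE3CurlOfGaugeDir
import Summits.QuantumFields.BalabanUV.T4Continuum.Support.NE3BlockPoincareTangent
import Summits.QuantumFields.BalabanUV.T4Continuum.Support.NE3SlicePoincareShape
import Summits.QuantumFields.BalabanUV.T4Continuum.Support.NE7SliceLetterBalabanGauge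
import HarnessLib

/-!
# NE7EnergyBlockLandauPoincare — THE POINCARÉ (COERCIVITY) INEQUALITY OF THE CORNER-FREE ENERGY BLOCK-LANDAU SLICE `𝒯_E(W)` FOLLOWS FROM ROW NE3's (P♮)_W ON
# `T_♮(W)` BY PURE ENERGY ALGEBRA: `SlicePoincare … (frameFreeBlockLandauW …) C ⟹ SlicePoincare … (energyBlockLandauW …) (4·card n·C)` under one k-free line

Cell `pub-balaban`, rung (B)+1 sub-cell t4, lineage `b2b-balaban-t4-ne7-p1` (CRUX PROVER NE7 #1 = OWNER of row NE7), generation 99; memo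
`t4/b2b-balaban-t4-ne7-p1-g99/ROAD-G99.md` §3.2∕§3.6 (a) («coercivity of 𝒯_E follows from 𝒯_♮'s … for free»).

WHY.  The Bałaban-slice road (memo §3) replaces row NE3's slice `T_♮(W) = frameFreeBlockLandauW` (corner-trivial generators `Ξ₀₀`, frame-free) by the corner-FREE energy
block-Landau slice `𝒯_E(W) = energyBlockLandauW` (gen 99, `NE7MeanZeroGaugeSliceW`: double-bar kernel ∩ `hsR`-orthogonal to `gaugeDir W (Ξ_Q(W))`).  The END's comparison argument
(`NE7ConvOneStepWeighted.isMinimiser_of_critical_rep_weighted`) needs, besides criticality (gen 99's `dAction_eq_zero_of_mem`), the slice Poincaré inequality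
`M⁻²·dirSq Y ≤ C·curlSq_W Y`.  THIS FILE derives it for `𝒯_E(W)` from row NE3's kernel theorem for `T_♮(W)` (`NE3SlicePoincareCurved` ∕ `NE3ClassSlicePoincare`, taken as the
hypothesis `SlicePoincare L (j+1) W (frameFreeBlockLandauW L N (j+1) W) C (periodBox (tower L N (j+1)))`) — NO new analysis, no carrier dictionary.
THE ARGUMENT.  `Y ∈ 𝒯_E(W)`; `f := framePotW Y`; `Y − gaugeDir W (spikeW M f)` is TANGENT (gen 99's `tangentIter_sub_spike`); row NE3's (E_W) decomposition
(`NE3FrameFreeDecompositionW.exists_cornerGauge_mem_frameFreeBlockLandauW`) gives a corner-trivial `μ₀` with `X♮ := Y − gaugeDir W (spikeW M f) + gaugeDir W μ₀ ∈ T_♮(W)`; the frame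
bookkeeping (`framePotW_add`, `framePotW_gaugeDir_spikeW`, `framePotW_gaugeDir`, `bmeanIterW_spikeW_pow`) shows `g := μ₀ − spikeW M f ∈ Ξ_Q(W)` (its nested block mean VANISHES), so
`X♮ = Y + gaugeDir W g` with `g ∈ Ξ_Q(W)`: by PYTHAGORAS in `𝒯_E` (`sum_nhsNormSq_add_gaugeDir_eq_of_mem`) `Σ nhs Y ≤ Σ nhs X♮` and `Σ nhs (gaugeDir W g) ≤ Σ nhs X♮`; (P♮)_W for `X♮`;
`curlSq X♮ ≤ 2·curlSq Y + 8x²·#Plane·Σ‖g‖²` (`NE3CurlOfGaugeDir.curlSq_sub_gaugeDir_le`); K6-Ξ (`NE3CornerGaugePoincare.sum_nhsNormSq_le_four_mul_of_bmeanIterW_eq_zero`: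
`Σ nhs g ≤ 4M²·Σ nhs (gaugeDir W g)`); absorb under the k-free line `32·card n·#Plane·C·(M²x)² ≤ 1∕2`.  Result: `M⁻²·dirSq Y ≤ 4·card n·C·curlSq_W Y`.
WHAT ([folklore]; 0 def, 0 sorry).  §1 bookkeeping (`sum_nhs_le_dirSq`, `bmeanIterW_sub`, `framePotW_sub_spike`); §2 **`exists_frameFree_companion`** (`X♮ = Y + gaugeDir W g`,
`X♮ ∈ T_♮(W)`, `g ∈ Ξ_Q(W)`); §3 **`slicePoincare_energyBlockLandauW_of_frameFree`**.
HONEST FRAMING (page 1): energy algebra over row NE3's kernel theorems; (P♮)_W for `T_♮` and K6-Ξ's smallness line are HYPOTHESES (both kernel-discharged on the class by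
`NE3ClassSlicePoincare` ∕ `NE3ClassRadiusFamily`); nothing of Bałaban's asserted; NE7 NOT PROVED; spine 0∕9; finite T⁴ rung (B)+1 — NOT infinite volume, NOT mass gap, NOT `BetaPertH`,
NOT Clay.  Continuum YM on T⁴ ⇐ BetaPertH ∧ nine spine estimates (0/9 proved); BetaPertH ⇐ (D1) ∧ (D4) ∧ CAP+tail; G-an2-4 gates asym, D1 and NE2/3/4.
-/

set_option autoImplicit false

namespace Summit.QuantumFields.BalabanUV.T4Continuum.NE7EnergyBlockLandauPoincare

open scoped BigOperators Matrix.Norms.L2Operator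
open Finset
open Literature.MathematicalPhysics.QuantumFieldTheory.Balaban1983to89
open B7Prop1Explicit B7Prop2Explicit MatrixNorms
open T4AveragingDeficitWall (IsUnitaryCfg IsSkewDir SmallField curlSq dirSq)
open T4AveragingDeficitWallBoundary (IsPeriodicCfg periodBox)
open AveragingDeficitPeriodicCounting (IsPeriodicDir)
open AveragingDeficitTwoLevelPrep (prop1Radius)
open AveragingDeficitMultiLevelPrep (cavgIter LevelSmall tower TangentIter)
open SpreadLift (loopRad)
open BlockAveragePushDirGauge (gaugeDir isPeriodicDir_gaugeDir)
open NE3TangentCovariantTower (QbarIter framePotW)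
open NE3CovariantBlockMean (bmeanIterW framePotW_gaugeDir)
open NE3CovariantCalculus (hsR)
open NE3LandauOrbit (gaugeDir_skew)
open NE3CurvedFrameKill (framePotW_skew_periodic framePotW_add)
open NE3FrameFreeSliceW (frameFreeBlockLandauW bmeanIterW_add bmeanIterW_smul)
open NE3FrameFreeDecompositionW (exists_cornerGauge_mem_frameFreeBlockLandauW gaugeDir_sub_fun)
open NE3CornerSpikes (spikeW spikeW_mem_skewAdjoint spikeW_add_period)
open NE7CornerSpikeTopDictionary (framePotW_gaugeDir_spikeW bmeanIterW_spikeW_pow natCast_tower_eq_pow_mul)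
open NE3CornerGaugePoincare (sum_nhsNormSq_le_four_mul_of_bmeanIterW_eq_zero)
open NE3CurlOfGaugeDir (curlSq_sub_gaugeDir_le)
open NE3BlockPoincareTangent (dirSq_le_card_mul_sum_nhs)
open NE3SlicePoincareShape (SlicePoincare)
open NE7SliceLetterBalabanGauge (gaugeDir_neg_pi)
open NE7QbarTangentCritical (tangentIter_sub_spike sub_add_dir)
open NE7MeanZeroGaugeSliceW (meanZeroGaugeSpaceW energyBlockLandauW sum_nhsNormSq_add_gaugeDir_eq_of_mem)

noncomputable section

variable {d : ℕ} {n : Type*} [Fintype n] [DecidableEq n]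

/-! ## §1 Bookkeeping -/

/-- `Σ nhsNormSq ≤ dirSq` (the normalised Hilbert–Schmidt square is below the operator-norm square). [folklore] -/
theorem sum_nhs_le_dirSq (Y : Site d → Fin d → Matrix n n ℂ) (F : Finset (Site d)) :
    ∑ y ∈ F, ∑ κ : Fin d, nhsNormSq (Y y κ) ≤ dirSq Y F := by
  unfold dirSq
  exact sum_le_sum fun y _ => sum_le_sum fun κ _ => nhsNormSq_le_opNorm_sq _

/-- `bmeanIterW` of a difference. [folklore] -/
theorem bmeanIterW_sub (L j : ℕ) (W : Site d → Fin d → (Matrix n n ℂ)ˣ) (A B : Site d → Matrix n n ℂ) :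
    bmeanIterW L j W (fun y => A y - B y) = fun z => bmeanIterW L j W A z - bmeanIterW L j W B z := by
  have h := bmeanIterW_add L j W (fun y => A y - B y) B
  have e : ((fun y => A y - B y) + B) = A := by funext y; simp
  rw [e] at h
  funext z
  have hz := congrArg (fun F => F z) h
  simp only [Pi.add_apply] at hz
  rw [hz]; abel

/-! ## §2 The frame-free companion of an element of `𝒯_E(W)` -/

/-- **THE FRAME-FREE COMPANION.**  Multi-level small-field class at a unitary `W` of period `tower L N (j+1)` (`L ≥ 2`, `2 ≤ L^d`); `Y` skew periodic with `QbarIter L (j+1) W Y = 0`.  Then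
there are a generator `g ∈ Ξ_Q(W)` (skew, periodic, nested block mean ZERO, corners free) and `X♮ ∈ T_♮(W) = frameFreeBlockLandauW L N (j+1) W` with `X♮ = Y + gaugeDir W g` pointwise —
`g = μ₀ − spikeW M (framePotW Y)` with row NE3's (E_W)-corrector `μ₀` of the spike-corrected tangent field. [folklore] -/
theorem exists_frameFree_companion [Nonempty n] {L N : ℕ} [NeZero N] (hL : 2 ≤ L) (hLd : 2 ≤ L ^ d) (j : ℕ)
    {W : Site d → Fin d → (Matrix n n ℂ)ˣ} {x : ℝ}
    (hWu : IsUnitaryCfg W) (hWP : IsPeriodicCfg W ((tower L N (j + 1) : ℕ) : ℤ)) (hx : 0 ≤ x) (hs : LevelSmall d L j x) (hWx : SmallField W x)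
    {Y : Site d → Fin d → Matrix n n ℂ} (hY : IsSkewDir Y) (hYP : IsPeriodicDir Y ((tower L N (j + 1) : ℕ) : ℤ))
    (hQ : QbarIter L (j + 1) W Y = 0) :
    ∃ (g : Site d → Matrix n n ℂ) (Xn : Site d → Fin d → Matrix n n ℂ),
      g ∈ meanZeroGaugeSpaceW (d := d) (n := n) L (j + 1) W (tower L N (j + 1)) ∧
      Xn ∈ frameFreeBlockLandauW (d := d) (n := n) L N (j + 1) W ∧
      ∀ y κ, Xn y κ = Y y κ + gaugeDir W g y κ := by
  have hL1 : 1 ≤ L := by omega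
  have hM : 1 ≤ L ^ (j + 1) := Nat.one_le_pow _ L (by omega)
  obtain ⟨hfs, hfP⟩ := framePotW_skew_periodic (M := N) hL1 j hWu hWP hx hs hWx hY hYP
  have h0s : ∀ z, (fun _ : Site d => (0 : Matrix n n ℂ)) z ∈ skewAdjoint (Matrix n n ℂ) := fun _ => (skewAdjoint _).zero_mem
  have h0P : ∀ (z : Site d) (τ : Fin d), (fun _ : Site d => (0 : Matrix n n ℂ)) (z + (N : ℤ) • e τ) = (fun _ : Site d => (0 : Matrix n n ℂ)) z :=
    fun _ _ => rfl
  have hQ' : QbarIter L (j + 1) W Y = gaugeDir (cavgIter L (j + 1) W) (fun _ => (0 : Matrix n n ℂ)) := by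
    rw [hQ, NE7QbarTangentCritical.gaugeDir_zero_fun']; rfl
  -- the heights `h := 0 + framePotW Y` are skew and `N`-periodic
  set h : Site d → Matrix n n ℂ := fun z => (0 : Matrix n n ℂ) + framePotW L (j + 1) W Y z with hhdef
  have hh : ∀ z, h z = framePotW L (j + 1) W Y z := fun z => by simp only [hhdef, zero_add]
  have hhs : ∀ z, h z ∈ skewAdjoint (Matrix n n ℂ) := fun z => by rw [hh]; exact hfs z
  have hhP : ∀ (z : Site d) (τ : Fin d), h (z + (N : ℤ) • e τ) = h z := by intro z τ; rw [hh, hh]; exact hfP z τ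
  have hσs : ∀ y, spikeW (L ^ (j + 1)) h y ∈ skewAdjoint (Matrix n n ℂ) := spikeW_mem_skewAdjoint _ hhs
  have hσP : ∀ (y : Site d) (i : Fin d), spikeW (L ^ (j + 1)) h (y + ((tower L N (j + 1) : ℕ) : ℤ) • e i) = spikeW (L ^ (j + 1)) h y := by
    intro y i; rw [natCast_tower_eq_pow_mul]; exact spikeW_add_period hM hhP y i
  -- the spike-corrected field is tangent, skew, periodic
  have hY't : TangentIter L j W (fun y μ => Y y μ - gaugeDir W (spikeW (L ^ (j + 1)) h) y μ) :=
    tangentIter_sub_spike hL1 j hWu hWP hx hs hWx hY hYP h0s h0P hQ'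
  have hY's : IsSkewDir (fun y μ => Y y μ - gaugeDir W (spikeW (L ^ (j + 1)) h) y μ) :=
    fun y μ => (skewAdjoint _).sub_mem (hY y μ) (gaugeDir_skew hWu hσs y μ)
  have hY'P : IsPeriodicDir (fun y μ => Y y μ - gaugeDir W (spikeW (L ^ (j + 1)) h) y μ) ((tower L N (j + 1) : ℕ) : ℤ) := by
    intro y i μ
    have h1 := hYP y i μ
    have h2 := isPeriodicDir_gaugeDir hWP hσP y i μ
    simp only
    rw [h1, h2]
  -- row NE3's (E_W) decomposition of the tangent field
  obtain ⟨mu, hmus, hmuP, hmu0, hmem⟩ := exists_cornerGauge_mem_frameFreeBlockLandauW (M := N) hL1 hLd j hWu hWP hx hs hWx hY's hY'P hY't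
  -- the total generator `g := μ₀ − spike`
  refine ⟨fun y => mu y - spikeW (L ^ (j + 1)) h y,
    fun y κ => (fun y μ => Y y μ - gaugeDir W (spikeW (L ^ (j + 1)) h) y μ) y κ + gaugeDir W mu y κ, ?_, hmem, ?_⟩
  · -- `g ∈ Ξ_Q(W)`: skew, periodic, nested mean zero
    refine ⟨⟨fun y κ => by simp only [hmuP, hσP], fun y => (skewAdjoint _).sub_mem (hmus y) (hσs y)⟩, ?_⟩
    have hff := hmem.2.2.2.1      -- frame-freeness of the companion
    have hc : ∀ z : Site d, bmeanIterW L (j + 1) W mu z = ((((L : ℝ) ^ d)⁻¹) ^ (j + 1)) • h z := by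
      intro z
      have e1 := framePotW_add hL1 j hWu hx hs hWx (fun y μ => Y y μ - gaugeDir W (spikeW (L ^ (j + 1)) h) y μ) (gaugeDir W mu) z
      have e2 := framePotW_gaugeDir (M := N) hL1 j hWu hWP hx hs hWx hmus hmuP z
      have e3 := framePotW_add hL1 j hWu hx hs hWx (fun y μ => Y y μ - gaugeDir W (spikeW (L ^ (j + 1)) h) y μ)
        (gaugeDir W (spikeW (L ^ (j + 1)) h)) z
      have e4 := framePotW_gaugeDir_spikeW hL1 j hWu hWP hx hs hWx hhs hhP z
      rw [sub_add_dir] at e3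
      -- `framePotW Y' z = bmeanIterW mu z` from frame-freeness of the companion
      have hz := hff z
      rw [e1, e2, hmu0 z, zero_sub] at hz
      have hz1 : framePotW L (j + 1) W (fun y μ => Y y μ - gaugeDir W (spikeW (L ^ (j + 1)) h) y μ) z = bmeanIterW L (j + 1) W mu z :=
        add_neg_eq_zero.mp hz
      -- `framePotW Y z = framePotW Y' z + (1 − c) • h z`
      rw [e4] at e3
      rw [← hz1]
      have hfY : framePotW L (j + 1) W (fun y μ => Y y μ - gaugeDir W (spikeW (L ^ (j + 1)) h) y μ) z
          = framePotW L (j + 1) W Y z - (1 - (((L : ℝ) ^ d)⁻¹) ^ (j + 1)) • h z := eq_sub_of_add_eq e3.symm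
      rw [hfY, ← hh z, sub_smul, one_smul]
      abel
    have hsp : ∀ z : Site d, bmeanIterW L (j + 1) W (spikeW (L ^ (j + 1)) h) z = ((((L : ℝ) ^ d)⁻¹) ^ (j + 1)) • h z := by
      intro z
      have h2 := bmeanIterW_spikeW_pow hL1 h (j + 1) W 1 z
      have e : (fun y => (1 : ℝ) • h y) = h := funext fun y => one_smul _ _
      rw [e, mul_one] at h2
      exact h2
    rw [bmeanIterW_sub]
    funext z
    rw [hc z, hsp z, sub_self]; rfl
  · -- pointwise identity `X♮ = Y + gaugeDir W g`
    intro y κ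
    simp only
    rw [gaugeDir_sub_fun]
    abel

/-! ## §3 The Poincaré inequality of `𝒯_E(W)` from that of `T_♮(W)` -/

/-- **SLICE POINCARÉ FOR THE ENERGY BLOCK-LANDAU SLICE FROM ROW NE3's (P♮)_W.**  Multi-level small-field class at a unitary `W` of period `tower L N (j+1)` (`L ≥ 2`, `2 ≤ L^d`,
`0 ≤ x`, `LevelSmall d L j x`, `SmallField W x`), K6-Ξ's smallness line `hK6`, and the k-free absorption line `32·card n·#Plane·C·((L^{j+1})²·x)² ≤ 1∕2` (`0 ≤ C`).  IF
`SlicePoincare L (j+1) W (frameFreeBlockLandauW L N (j+1) W) C (periodBox (tower L N (j+1)))` THEN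
`SlicePoincare L (j+1) W (energyBlockLandauW L N (j+1) W) (4·card n·C) (periodBox (tower L N (j+1)))`. [folklore] -/
theorem slicePoincare_energyBlockLandauW_of_frameFree [Nonempty n] {L N : ℕ} [NeZero N] (hL : 2 ≤ L) (hLd : 2 ≤ L ^ d) (j : ℕ)
    {W : Site d → Fin d → (Matrix n n ℂ)ˣ} {x : ℝ}
    (hWu : IsUnitaryCfg W) (hWP : IsPeriodicCfg W ((tower L N (j + 1) : ℕ) : ℤ)) (hx : 0 ≤ x) (hs : LevelSmall d L j x) (hWx : SmallField W x)
    (hK6 : 8 * d * (((L : ℝ) ^ (j + 1)) * (((d : ℝ) - 1) * (((L : ℝ) ^ (j + 1)) - 1) * x)) ^ 2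
      + 2 * (Fintype.card n * (4 * (d : ℝ) ^ 2 * ((L : ℝ) ^ (j + 1) - 1) ^ 2 * x + 16 * d * loopRad d L ((prop1Radius d L)^[j] x)) ^ 2)
        ≤ 1 / 2)
    {C : ℝ} (hC : 0 ≤ C)
    (habs : 32 * (Fintype.card n : ℝ) * (Fintype.card (T4AveragingDeficitWall.Plane d) : ℝ) * C * ((((L : ℝ) ^ (j + 1)) ^ 2) * x) ^ 2 ≤ 1 / 2)
    (hP : SlicePoincare L (j + 1) W (frameFreeBlockLandauW (d := d) (n := n) L N (j + 1) W) C (periodBox (d := d) (tower L N (j + 1)))) :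
    SlicePoincare L (j + 1) W (energyBlockLandauW (d := d) (n := n) L N (j + 1) W) (4 * (Fintype.card n : ℝ) * C)
      (periodBox (d := d) (tower L N (j + 1))) := by
  have hL1 : 1 ≤ L := by omega
  have htower : tower L N (j + 1) = L ^ (j + 1) * N := by exact_mod_cast natCast_tower_eq_pow_mul L N (j + 1)
  intro Y hY
  obtain ⟨hYs, hYP, hQ, horth⟩ := hY
  have hM0 : (0 : ℝ) < (L : ℝ) ^ (j + 1) := by positivity
  -- the frame-free companion `X♮ = Y + gaugeDir W g`, `g ∈ Ξ_Q(W)`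
  obtain ⟨g, Xn, hg, hXn, hXeq⟩ := exists_frameFree_companion hL hLd j hWu hWP hx hs hWx hYs hYP hQ
  obtain ⟨⟨hgP, hgs⟩, hg0⟩ := NE7MeanZeroGaugeSliceW.mem_meanZeroGaugeSpaceW_iff.mp hg
  -- Pythagoras in `𝒯_E(W)`
  have hpy := sum_nhsNormSq_add_gaugeDir_eq_of_mem (L := L) (N := N) (k := j + 1) (W := W) ⟨hYs, hYP, hQ, horth⟩ hg
  have hXeq' : ∑ y ∈ periodBox (d := d) (tower L N (j + 1)), ∑ κ : Fin d, nhsNormSq (Xn y κ)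
      = ∑ y ∈ periodBox (d := d) (tower L N (j + 1)), ∑ κ : Fin d, nhsNormSq (Y y κ + gaugeDir W g y κ) := by
    refine sum_congr rfl fun y _ => sum_congr rfl fun κ _ => ?_; rw [hXeq]
  have hnn1 : 0 ≤ ∑ y ∈ periodBox (d := d) (tower L N (j + 1)), ∑ κ : Fin d, nhsNormSq (Y y κ) :=
    sum_nonneg fun _ _ => sum_nonneg fun _ _ => nhsNormSq_nonneg _
  have hnn2 : 0 ≤ ∑ y ∈ periodBox (d := d) (tower L N (j + 1)), ∑ κ : Fin d, nhsNormSq (gaugeDir W g y κ) :=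
    sum_nonneg fun _ _ => sum_nonneg fun _ _ => nhsNormSq_nonneg _
  have hY_le : ∑ y ∈ periodBox (d := d) (tower L N (j + 1)), ∑ κ : Fin d, nhsNormSq (Y y κ)
      ≤ ∑ y ∈ periodBox (d := d) (tower L N (j + 1)), ∑ κ : Fin d, nhsNormSq (Xn y κ) := by rw [hXeq', hpy]; linarith
  have hG_le : ∑ y ∈ periodBox (d := d) (tower L N (j + 1)), ∑ κ : Fin d, nhsNormSq (gaugeDir W g y κ)
      ≤ ∑ y ∈ periodBox (d := d) (tower L N (j + 1)), ∑ κ : Fin d, nhsNormSq (Xn y κ) := by rw [hXeq', hpy]; linarith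
  -- (P♮)_W for the companion
  have hPn : (((L : ℝ) ^ (j + 1))⁻¹) ^ 2 * dirSq Xn (periodBox (d := d) (tower L N (j + 1)))
      ≤ C * curlSq W Xn (periodBox (d := d) (tower L N (j + 1))) := hP Xn hXn
  -- the curl of the companion: `X♮ = Y − gaugeDir W (−g)`
  have hXsub : Xn = fun y κ => Y y κ - gaugeDir W (fun z => -g z) y κ := by
    funext y κ; rw [hXeq, gaugeDir_neg_pi]; abel
  have hcurl : curlSq W Xn (periodBox (d := d) (tower L N (j + 1))) ≤ 2 * curlSq W Y (periodBox (d := d) (tower L N (j + 1)))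
      + 8 * x ^ 2 * (Fintype.card (T4AveragingDeficitWall.Plane d)) * ∑ z ∈ periodBox (d := d) (tower L N (j + 1)), ‖g z‖ ^ 2 := by
    have h := curlSq_sub_gaugeDir_le hWu hWx Y (fun z => -g z) (periodBox (d := d) (tower L N (j + 1)))
    rw [← hXsub] at h
    simpa only [norm_neg] using h
  -- K6-Ξ for `g` (nested mean zero everywhere)
  have hK : ∑ z ∈ periodBox (d := d) (tower L N (j + 1)), nhsNormSq (g z)
      ≤ 4 * (((L : ℝ) ^ (j + 1)) ^ 2 * ∑ y ∈ periodBox (d := d) (tower L N (j + 1)), ∑ μ : Fin d, nhsNormSq (gaugeDir W g y μ)) := by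
    have h := sum_nhsNormSq_le_four_mul_of_bmeanIterW_eq_zero hL j hWu hx hs hWx N g (fun z _ => by rw [hg0]; rfl) hK6
    rw [← htower] at h
    exact h
  -- operator norms vs. normalised Hilbert–Schmidt
  have hg_op : ∑ z ∈ periodBox (d := d) (tower L N (j + 1)), ‖g z‖ ^ 2
      ≤ (Fintype.card n : ℝ) * ∑ z ∈ periodBox (d := d) (tower L N (j + 1)), nhsNormSq (g z) := by
    rw [mul_sum]; exact sum_le_sum fun z _ => opNorm_sq_le_card_mul_nhsNormSq _
  have hXn_nhs : ∑ y ∈ periodBox (d := d) (tower L N (j + 1)), ∑ κ : Fin d, nhsNormSq (Xn y κ)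
      ≤ dirSq Xn (periodBox (d := d) (tower L N (j + 1))) := sum_nhs_le_dirSq Xn _
  have hY_dir : dirSq Y (periodBox (d := d) (tower L N (j + 1)))
      ≤ (Fintype.card n : ℝ) * ∑ y ∈ periodBox (d := d) (tower L N (j + 1)), ∑ κ : Fin d, nhsNormSq (Y y κ) := dirSq_le_card_mul_sum_nhs Y _
  -- assemble
  have hcn : (0 : ℝ) ≤ Fintype.card n := by positivity
  have hPl : (0 : ℝ) ≤ Fintype.card (T4AveragingDeficitWall.Plane d) := by positivity
  have hcurlY : 0 ≤ curlSq W Y (periodBox (d := d) (tower L N (j + 1))) := by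
    unfold curlSq; exact sum_nonneg fun _ _ => sum_nonneg fun _ _ => sq_nonneg _
  have hdirXn : 0 ≤ dirSq Xn (periodBox (d := d) (tower L N (j + 1))) := by
    unfold dirSq; exact sum_nonneg fun _ _ => sum_nonneg fun _ _ => sq_nonneg _
  have hgg : 0 ≤ ∑ z ∈ periodBox (d := d) (tower L N (j + 1)), ‖g z‖ ^ 2 := sum_nonneg fun _ _ => sq_nonneg _
  -- chain: Σ‖g‖² ≤ card n · 4 M² · dirSq X♮
  have hg_chain : ∑ z ∈ periodBox (d := d) (tower L N (j + 1)), ‖g z‖ ^ 2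
      ≤ (Fintype.card n : ℝ) * (4 * (((L : ℝ) ^ (j + 1)) ^ 2 * dirSq Xn (periodBox (d := d) (tower L N (j + 1))))) := by
    have hGX : ∑ y ∈ periodBox (d := d) (tower L N (j + 1)), ∑ μ : Fin d, nhsNormSq (gaugeDir W g y μ)
        ≤ dirSq Xn (periodBox (d := d) (tower L N (j + 1))) := hG_le.trans hXn_nhs
    have hM2 : 0 ≤ ((L : ℝ) ^ (j + 1)) ^ 2 := sq_nonneg _
    have h3 : 4 * (((L : ℝ) ^ (j + 1)) ^ 2 * ∑ y ∈ periodBox (d := d) (tower L N (j + 1)), ∑ μ : Fin d, nhsNormSq (gaugeDir W g y μ))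
        ≤ 4 * (((L : ℝ) ^ (j + 1)) ^ 2 * dirSq Xn (periodBox (d := d) (tower L N (j + 1)))) := by
      have := mul_le_mul_of_nonneg_left hGX hM2; linarith
    exact hg_op.trans (mul_le_mul_of_nonneg_left (hK.trans h3) hcn)
  -- (P♮)_W + curl bound
  have h1 : C * curlSq W Xn (periodBox (d := d) (tower L N (j + 1)))
      ≤ C * (2 * curlSq W Y (periodBox (d := d) (tower L N (j + 1)))
        + 8 * x ^ 2 * (Fintype.card (T4AveragingDeficitWall.Plane d)) * ∑ z ∈ periodBox (d := d) (tower L N (j + 1)), ‖g z‖ ^ 2) :=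
    mul_le_mul_of_nonneg_left hcurl hC
  have hx2 : 0 ≤ C * (8 * x ^ 2 * (Fintype.card (T4AveragingDeficitWall.Plane d) : ℝ)) := by positivity
  have h2 : C * (8 * x ^ 2 * (Fintype.card (T4AveragingDeficitWall.Plane d) : ℝ)) * ∑ z ∈ periodBox (d := d) (tower L N (j + 1)), ‖g z‖ ^ 2
      ≤ C * (8 * x ^ 2 * (Fintype.card (T4AveragingDeficitWall.Plane d) : ℝ))
        * ((Fintype.card n : ℝ) * (4 * (((L : ℝ) ^ (j + 1)) ^ 2 * dirSq Xn (periodBox (d := d) (tower L N (j + 1)))))) :=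
    mul_le_mul_of_nonneg_left hg_chain hx2
  have hmain : (((L : ℝ) ^ (j + 1))⁻¹) ^ 2 * dirSq Xn (periodBox (d := d) (tower L N (j + 1)))
      ≤ 2 * C * curlSq W Y (periodBox (d := d) (tower L N (j + 1)))
        + 32 * (Fintype.card n : ℝ) * (Fintype.card (T4AveragingDeficitWall.Plane d) : ℝ) * C * x ^ 2 * ((L : ℝ) ^ (j + 1)) ^ 2
          * dirSq Xn (periodBox (d := d) (tower L N (j + 1))) := by
    have e : C * (8 * x ^ 2 * (Fintype.card (T4AveragingDeficitWall.Plane d) : ℝ))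
        * ((Fintype.card n : ℝ) * (4 * (((L : ℝ) ^ (j + 1)) ^ 2 * dirSq Xn (periodBox (d := d) (tower L N (j + 1))))))
        = 32 * (Fintype.card n : ℝ) * (Fintype.card (T4AveragingDeficitWall.Plane d) : ℝ) * C * x ^ 2 * ((L : ℝ) ^ (j + 1)) ^ 2
          * dirSq Xn (periodBox (d := d) (tower L N (j + 1))) := by ring
    have e' : C * (2 * curlSq W Y (periodBox (d := d) (tower L N (j + 1)))
        + 8 * x ^ 2 * (Fintype.card (T4AveragingDeficitWall.Plane d)) * ∑ z ∈ periodBox (d := d) (tower L N (j + 1)), ‖g z‖ ^ 2)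
        = 2 * C * curlSq W Y (periodBox (d := d) (tower L N (j + 1)))
          + C * (8 * x ^ 2 * (Fintype.card (T4AveragingDeficitWall.Plane d) : ℝ)) * ∑ z ∈ periodBox (d := d) (tower L N (j + 1)), ‖g z‖ ^ 2 := by
      ring
    rw [e'] at h1; rw [e] at h2
    linarith
  -- absorb: the coefficient of `dirSq X♮` on the right is at most half of `M⁻²`
  have habs' : 32 * (Fintype.card n : ℝ) * (Fintype.card (T4AveragingDeficitWall.Plane d) : ℝ) * C * x ^ 2 * ((L : ℝ) ^ (j + 1)) ^ 2
      ≤ (1 / 2) * (((L : ℝ) ^ (j + 1))⁻¹) ^ 2 := by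
    have hM2 : 0 < ((L : ℝ) ^ (j + 1)) ^ 2 := by positivity
    have e : (1 / 2 : ℝ) * (((L : ℝ) ^ (j + 1))⁻¹) ^ 2 = (1 / 2) / ((L : ℝ) ^ (j + 1)) ^ 2 := by rw [inv_pow]; ring
    rw [e, le_div_iff₀ hM2]
    have e2 : 32 * (Fintype.card n : ℝ) * (Fintype.card (T4AveragingDeficitWall.Plane d) : ℝ) * C * x ^ 2 * ((L : ℝ) ^ (j + 1)) ^ 2
        * ((L : ℝ) ^ (j + 1)) ^ 2
        = 32 * (Fintype.card n : ℝ) * (Fintype.card (T4AveragingDeficitWall.Plane d) : ℝ) * C * ((((L : ℝ) ^ (j + 1)) ^ 2) * x) ^ 2 := by ring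
    rw [e2]; exact habs
  have h4 : 32 * (Fintype.card n : ℝ) * (Fintype.card (T4AveragingDeficitWall.Plane d) : ℝ) * C * x ^ 2 * ((L : ℝ) ^ (j + 1)) ^ 2
        * dirSq Xn (periodBox (d := d) (tower L N (j + 1)))
      ≤ (1 / 2) * (((L : ℝ) ^ (j + 1))⁻¹) ^ 2 * dirSq Xn (periodBox (d := d) (tower L N (j + 1))) :=
    mul_le_mul_of_nonneg_right habs' hdirXn
  have hXn_bound : (((L : ℝ) ^ (j + 1))⁻¹) ^ 2 * dirSq Xn (periodBox (d := d) (tower L N (j + 1)))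
      ≤ 4 * C * curlSq W Y (periodBox (d := d) (tower L N (j + 1))) := by
    linarith
  -- finally `Y`: `dirSq Y ≤ card n · dirSq X♮`
  have hYXn : dirSq Y (periodBox (d := d) (tower L N (j + 1))) ≤ (Fintype.card n : ℝ) * dirSq Xn (periodBox (d := d) (tower L N (j + 1))) :=
    hY_dir.trans (mul_le_mul_of_nonneg_left (hY_le.trans hXn_nhs) hcn)
  have hinv0 : 0 ≤ (((L : ℝ) ^ (j + 1))⁻¹) ^ 2 := sq_nonneg _
  calc (((L : ℝ) ^ (j + 1))⁻¹) ^ 2 * dirSq Y (periodBox (d := d) (tower L N (j + 1)))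
      ≤ (((L : ℝ) ^ (j + 1))⁻¹) ^ 2 * ((Fintype.card n : ℝ) * dirSq Xn (periodBox (d := d) (tower L N (j + 1)))) :=
        mul_le_mul_of_nonneg_left hYXn hinv0
    _ = (Fintype.card n : ℝ) * ((((L : ℝ) ^ (j + 1))⁻¹) ^ 2 * dirSq Xn (periodBox (d := d) (tower L N (j + 1)))) := by ring
    _ ≤ (Fintype.card n : ℝ) * (4 * C * curlSq W Y (periodBox (d := d) (tower L N (j + 1)))) := mul_le_mul_of_nonneg_left hXn_bound hcn
    _ = 4 * (Fintype.card n : ℝ) * C * curlSq W Y (periodBox (d := d) (tower L N (j + 1))) := by ring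

end

end Summit.QuantumFields.BalabanUV.T4Continuum.NE7EnergyBlockLandauPoincare
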